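import Mathlib
import HarnessLib
import Summits.HubbardSuperconductivity.HubbardSuperconductivity.Theorems.KLProgrammeKLRegimeSplitPolarAngleDerivBounds

/-!
# Route `KLProgramme`, crux K3 — gen-8 ENGINE-FLOW child (stmt-HubbardSuperconductivity-20437), stub (C) `stub_twoLeg_curvature`, door (C1):
# BELL-GRADED chain-rule bounds `‖Dⁿ(g∘θ)‖`, `n ≤ 4`, for a scalar field `θ` and a function `g` of one variable, and the GRADED local sizes
# of a periodic function of the polar angle

Seat hubbard-kl-k3c3-p1 (g5).  The (C1) door (`…JacksonRemainderCurve/Flow`, p533543/p533953) reads LOCAL sizes `Ml n` of the G-extension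
`mean f + (f − mean f)∘polarAngle` near the flow curve.  The tree's tool (k3c3-p1 g2 `norm_iteratedFDeriv_comp_polarAngle_le`, Mathlib's
`norm_iteratedFDerivWithin_comp_le` inside) is SINGLE-constant: `‖Dⁿ(g∘θ)‖ ≤ n!·G·Θⁿ` with `G ≥ ‖Dⁱg‖` for ALL `i ≤ n` — at order `4` this is
`144·G/ρ⁴` with `G = max_i sup|g^{(i)}|`, whereas the flow readings are strongly GRADED (`|f′| ∝ 4^{−n}`, `|f⁗| ∝ 16^{n}`).  This file proves the
Faà di Bruno / Bell-polynomial form, orders `1 … 4`, by the recursion `D(g∘θ) = (g′∘θ)·Dθ` + Leibniz (`norm_iteratedFDerivWithin_smul_le`):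

* §1 `norm_iteratedFDerivWithin_comp_succ_le` (the recursion on an open chart), `norm_iteratedFDeriv_comp_le_graded` (**orders 1–4**:
  `b₁X₁ | b₂X₁² + b₁X₂ | b₃X₁³ + 3b₂X₁X₂ + b₁X₃ | b₄X₁⁴ + 6b₃X₁²X₂ + b₂(3X₂² + 4X₁X₃) + b₁X₄`, with `‖Dᵏg‖ ≤ b k` on `ℝ` and `‖Dʲθ(x)‖ ≤ X j`
  AT THE POINT, `θ` of class `C⁴` on an open set `U ∋ x`);
* §2 the argument / polar angle (`‖Dʲ arg(z)‖ ≤ (j−1)!/‖z‖ʲ`, k3c3-p1 g2): **`norm_iteratedFDeriv_comp_polarAngle_le_graded`** — for `g` `C⁴`,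
  `2π`-periodic, `‖q‖ ≥ ρ > 0`: `‖D⁴(g∘polarAngle)(q)‖ ≤ (b₄ + 6b₃ + 11b₂ + 6b₁)/ρ⁴`, `‖D³‖ ≤ (b₃ + 3b₂ + 2b₁)/ρ³`, `‖D²‖ ≤ (b₂ + b₁)/ρ²`,
  `‖D¹‖ ≤ b₁/ρ`.

Pure real analysis; no definitions; nothing about the model; nothing here asserts superconductivity.
-/

noncomputable section

namespace Summit.HubbardSuperconductivity.HubbardSuperconductivity.Theorems.KLRegimeSplit

set_option linter.dupNamespace false -- summit = problem name (single-conjunct summit), D-0017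

open Real Finset Complex Filter Literature.MathematicalPhysics.QuantumLattice Literature.Analysis.SpecialFunctions
open scoped Topology

/-! ## §1 The graded chain rule on an open chart -/

section Graded

variable {E : Type*} [NormedAddCommGroup E] [NormedSpace ℝ E] {θ : E → ℝ} {U : Set E} {x : E}

/-- The within-chain rule for a scalar outer function: `D(h∘θ) = h′(θ)·Dθ` on `U`. -/
theorem fderivWithin_comp_eq_deriv_smul {h : ℝ → ℝ} (hU : IsOpen U) {y : E} (hy : y ∈ U) (hh : DifferentiableAt ℝ h (θ y))
    (hθ : DifferentiableWithinAt ℝ θ U y) :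
    fderivWithin ℝ (fun z => h (θ z)) U y = deriv h (θ y) • fderivWithin ℝ θ U y := by
  rw [show (fun z => h (θ z)) = h ∘ θ from rfl, fderiv_comp_fderivWithin y hh hθ (hU.uniqueDiffWithinAt hy)]
  ext v
  rw [ContinuousLinearMap.comp_apply, fderiv_eq_smul_deriv, smul_eq_mul,
    show (deriv h (θ y) • fderivWithin ℝ θ U y) v = deriv h (θ y) • fderivWithin ℝ θ U y v from rfl, smul_eq_mul, mul_comm]

/-- **The recursion** (open chart `U ∋ x`, `h ∈ C^{n+1}`, `θ ∈ C^{n+1}(U)`):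
`‖D^{n+1}(h∘θ)(x)‖ ≤ Σ_{i ≤ n} C(n,i)·‖Dⁱ(h′∘θ)(x)‖·‖D^{n−i+1}θ(x)‖` (all derivatives within `U`). -/
theorem norm_iteratedFDerivWithin_comp_succ_le {h : ℝ → ℝ} (hU : IsOpen U) (hx : x ∈ U) {n : ℕ}
    (hh : ContDiff ℝ (n + 1) h) (hθ : ContDiffOn ℝ (n + 1) θ U) :
    ‖iteratedFDerivWithin ℝ (n + 1) (fun z => h (θ z)) U x‖ ≤
      ∑ i ∈ Finset.range (n + 1), (n.choose i : ℝ) * ‖iteratedFDerivWithin ℝ i (fun z => deriv h (θ z)) U x‖ *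
        ‖iteratedFDerivWithin ℝ (n - i + 1) θ U x‖ := by
  have hUd : UniqueDiffOn ℝ U := hU.uniqueDiffOn
  rw [← norm_iteratedFDerivWithin_fderivWithin hUd hx]
  -- on `U` the derivative is `h′(θ)·Dθ`
  have heq : Set.EqOn (fderivWithin ℝ (fun z => h (θ z)) U) (fun y => deriv h (θ y) • fderivWithin ℝ θ U y) U := by
    intro y hy
    exact fderivWithin_comp_eq_deriv_smul hU hy ((hh.differentiable (by simp)).differentiableAt)
      ((hθ.differentiableOn (by simp)) y hy)
  rw [iteratedFDerivWithin_congr heq hx]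
  -- Leibniz
  have hn1 : ((n : ℕ) : WithTop ℕ∞) + 1 ≤ ((n + 1 : ℕ) : WithTop ℕ∞) := by push_cast; exact le_rfl
  have hh' : ContDiff ℝ n (deriv h) := (contDiff_succ_iff_deriv.mp hh).2.2
  have hf : ContDiffOn ℝ n (fun y => deriv h (θ y)) U := hh'.comp_contDiffOn (hθ.of_le (by simp))
  have hg : ContDiffOn ℝ n (fun y => fderivWithin ℝ θ U y) U := hθ.fderivWithin hUd hn1
  have hL := norm_iteratedFDerivWithin_smul_le (𝕜 := ℝ) hf hg hUd hx (n := n) le_rfl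
  refine hL.trans (le_of_eq ?_)
  refine Finset.sum_congr rfl fun i hi => ?_
  rw [Finset.mem_range] at hi
  rw [norm_iteratedFDerivWithin_fderivWithin hUd hx]

/-- Order zero within: `‖D⁰(h∘θ)(x)‖ = |h(θ x)|`. -/
theorem norm_iteratedFDerivWithin_zero_comp {h : ℝ → ℝ} :
    ‖iteratedFDerivWithin ℝ 0 (fun z => h (θ z)) U x‖ = |h (θ x)| := by
  rw [norm_iteratedFDerivWithin_zero, Real.norm_eq_abs]

/-- The derivatives of `deriv h` are the shifted derivatives of `h`: `‖Dᵏ(h′)(t)‖ = ‖D^{k+1}h(t)‖`. -/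
theorem norm_iteratedFDeriv_deriv_eq (h : ℝ → ℝ) (k : ℕ) (t : ℝ) :
    ‖iteratedFDeriv ℝ k (deriv h) t‖ = ‖iteratedFDeriv ℝ (k + 1) h t‖ := by
  rw [norm_iteratedFDeriv_eq_norm_iteratedDeriv, norm_iteratedFDeriv_eq_norm_iteratedDeriv, iteratedDeriv_succ']

/-- `|h′(s)| = ‖D¹h(s)‖`. -/
theorem abs_deriv_eq_norm_iteratedFDeriv_one (h : ℝ → ℝ) (s : ℝ) : |deriv h s| = ‖iteratedFDeriv ℝ 1 h s‖ := by
  rw [norm_iteratedFDeriv_eq_norm_iteratedDeriv, iteratedDeriv_one, Real.norm_eq_abs]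

/-- **Order one** (within an open chart): `‖D¹(h∘θ)(x)‖ ≤ b₁·‖D¹θ(x)‖` for `‖D¹h‖ ≤ b₁`. -/
theorem norm_iteratedFDerivWithin_one_comp_le {h : ℝ → ℝ} (hU : IsOpen U) (hx : x ∈ U) (hh : ContDiff ℝ 1 h)
    (hθ : ContDiffOn ℝ 1 θ U) {b₁ : ℝ} (hb₁ : ∀ t, ‖iteratedFDeriv ℝ 1 h t‖ ≤ b₁) :
    ‖iteratedFDerivWithin ℝ 1 (fun z => h (θ z)) U x‖ ≤ b₁ * ‖iteratedFDerivWithin ℝ 1 θ U x‖ := by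
  have hrec := norm_iteratedFDerivWithin_comp_succ_le hU hx (n := 0) hh hθ
  simp only [zero_add, Finset.range_one, Finset.sum_singleton, Nat.choose_self, Nat.cast_one, one_mul, Nat.sub_zero] at hrec
  rw [norm_iteratedFDerivWithin_zero_comp, abs_deriv_eq_norm_iteratedFDeriv_one] at hrec
  exact hrec.trans (mul_le_mul_of_nonneg_right (hb₁ _) (norm_nonneg _))

/-- **Order two**: `‖D²(h∘θ)(x)‖ ≤ b₂·X₁² + b₁·X₂`. -/
theorem norm_iteratedFDerivWithin_two_comp_le {h : ℝ → ℝ} (hU : IsOpen U) (hx : x ∈ U) (hh : ContDiff ℝ 2 h)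
    (hθ : ContDiffOn ℝ 2 θ U) {b₁ b₂ X₁ X₂ : ℝ} (hb₁ : ∀ t, ‖iteratedFDeriv ℝ 1 h t‖ ≤ b₁) (hb₂ : ∀ t, ‖iteratedFDeriv ℝ 2 h t‖ ≤ b₂)
    (hX₁ : ‖iteratedFDerivWithin ℝ 1 θ U x‖ ≤ X₁) (hX₂ : ‖iteratedFDerivWithin ℝ 2 θ U x‖ ≤ X₂) :
    ‖iteratedFDerivWithin ℝ 2 (fun z => h (θ z)) U x‖ ≤ b₂ * X₁ ^ 2 + b₁ * X₂ := by
  have hb₁0 : 0 ≤ b₁ := (norm_nonneg _).trans (hb₁ 0)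
  have hb₂0 : 0 ≤ b₂ := (norm_nonneg _).trans (hb₂ 0)
  have hX₁0 : 0 ≤ X₁ := (norm_nonneg _).trans hX₁
  have hrec := norm_iteratedFDerivWithin_comp_succ_le hU hx (n := 1) hh hθ
  simp only [Finset.sum_range_succ, Finset.sum_range_zero, zero_add, Nat.choose_zero_right, Nat.cast_one, one_mul, Nat.sub_zero,
    Nat.choose_self] at hrec
  rw [norm_iteratedFDerivWithin_zero_comp, abs_deriv_eq_norm_iteratedFDeriv_one] at hrec
  -- the order-1 bound for `h′`
  have hh' : ContDiff ℝ 1 (deriv h) := (contDiff_succ_iff_deriv (n := 1).mp hh).2.2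
  have h1 := norm_iteratedFDerivWithin_one_comp_le hU hx hh' (hθ.of_le (by norm_num)) (b₁ := b₂)
    (fun t => by rw [norm_iteratedFDeriv_deriv_eq]; exact hb₂ t)
  calc ‖iteratedFDerivWithin ℝ 2 (fun z => h (θ z)) U x‖
      ≤ ‖iteratedFDeriv ℝ 1 h (θ x)‖ * ‖iteratedFDerivWithin ℝ 2 θ U x‖ +
          ‖iteratedFDerivWithin ℝ 1 (fun z => deriv h (θ z)) U x‖ * ‖iteratedFDerivWithin ℝ 1 θ U x‖ := by
        simpa using hrec
    _ ≤ b₁ * X₂ + (b₂ * X₁) * X₁ := by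
        gcongr
        · exact hb₁ _
        · exact h1.trans (mul_le_mul_of_nonneg_left hX₁ hb₂0)
    _ = b₂ * X₁ ^ 2 + b₁ * X₂ := by ring

/-- **Order three**: `‖D³(h∘θ)(x)‖ ≤ b₃·X₁³ + 3b₂·X₁X₂ + b₁·X₃`. -/
theorem norm_iteratedFDerivWithin_three_comp_le {h : ℝ → ℝ} (hU : IsOpen U) (hx : x ∈ U) (hh : ContDiff ℝ 3 h)
    (hθ : ContDiffOn ℝ 3 θ U) {b₁ b₂ b₃ X₁ X₂ X₃ : ℝ} (hb₁ : ∀ t, ‖iteratedFDeriv ℝ 1 h t‖ ≤ b₁)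
    (hb₂ : ∀ t, ‖iteratedFDeriv ℝ 2 h t‖ ≤ b₂) (hb₃ : ∀ t, ‖iteratedFDeriv ℝ 3 h t‖ ≤ b₃)
    (hX₁ : ‖iteratedFDerivWithin ℝ 1 θ U x‖ ≤ X₁) (hX₂ : ‖iteratedFDerivWithin ℝ 2 θ U x‖ ≤ X₂)
    (hX₃ : ‖iteratedFDerivWithin ℝ 3 θ U x‖ ≤ X₃) :
    ‖iteratedFDerivWithin ℝ 3 (fun z => h (θ z)) U x‖ ≤ b₃ * X₁ ^ 3 + 3 * b₂ * X₁ * X₂ + b₁ * X₃ := by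
  have hb₁0 : 0 ≤ b₁ := (norm_nonneg _).trans (hb₁ 0)
  have hb₂0 : 0 ≤ b₂ := (norm_nonneg _).trans (hb₂ 0)
  have hb₃0 : 0 ≤ b₃ := (norm_nonneg _).trans (hb₃ 0)
  have hX₁0 : 0 ≤ X₁ := (norm_nonneg _).trans hX₁
  have hX₂0 : 0 ≤ X₂ := (norm_nonneg _).trans hX₂
  have hrec := norm_iteratedFDerivWithin_comp_succ_le hU hx (n := 2) hh hθ
  simp only [Finset.sum_range_succ, Finset.sum_range_zero, zero_add, Nat.choose_zero_right, Nat.cast_one, one_mul, Nat.sub_zero,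
    Nat.choose_self, show Nat.choose 2 1 = 2 by rfl] at hrec
  rw [norm_iteratedFDerivWithin_zero_comp, abs_deriv_eq_norm_iteratedFDeriv_one] at hrec
  have hh' : ContDiff ℝ 2 (deriv h) := (contDiff_succ_iff_deriv (n := 2).mp hh).2.2
  have hb₁' : ∀ t, ‖iteratedFDeriv ℝ 1 (deriv h) t‖ ≤ b₂ := fun t => by rw [norm_iteratedFDeriv_deriv_eq]; exact hb₂ t
  have hb₂' : ∀ t, ‖iteratedFDeriv ℝ 2 (deriv h) t‖ ≤ b₃ := fun t => by rw [norm_iteratedFDeriv_deriv_eq]; exact hb₃ t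
  have h1 := norm_iteratedFDerivWithin_one_comp_le hU hx (hh'.of_le (by norm_num)) (hθ.of_le (by norm_num)) hb₁'
  have h2 := norm_iteratedFDerivWithin_two_comp_le hU hx hh' (hθ.of_le (by norm_num)) hb₁' hb₂' hX₁ hX₂
  calc ‖iteratedFDerivWithin ℝ 3 (fun z => h (θ z)) U x‖
      ≤ ‖iteratedFDeriv ℝ 1 h (θ x)‖ * ‖iteratedFDerivWithin ℝ 3 θ U x‖ +
          2 * ‖iteratedFDerivWithin ℝ 1 (fun z => deriv h (θ z)) U x‖ * ‖iteratedFDerivWithin ℝ 2 θ U x‖ +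
          ‖iteratedFDerivWithin ℝ 2 (fun z => deriv h (θ z)) U x‖ * ‖iteratedFDerivWithin ℝ 1 θ U x‖ := by
        simpa [show (2 : ℕ) - 1 + 1 = 2 from rfl] using hrec
    _ ≤ b₁ * X₃ + 2 * (b₂ * X₁) * X₂ + (b₃ * X₁ ^ 2 + b₂ * X₂) * X₁ := by
        gcongr
        · exact hb₁ _
        · exact h1.trans (mul_le_mul_of_nonneg_left hX₁ hb₂0)
    _ = b₃ * X₁ ^ 3 + 3 * b₂ * X₁ * X₂ + b₁ * X₃ := by ring

/-- **Order four**: `‖D⁴(h∘θ)(x)‖ ≤ b₄·X₁⁴ + 6b₃·X₁²X₂ + b₂·(3X₂² + 4X₁X₃) + b₁·X₄` (Faà di Bruno / Bell). -/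
theorem norm_iteratedFDerivWithin_four_comp_le {h : ℝ → ℝ} (hU : IsOpen U) (hx : x ∈ U) (hh : ContDiff ℝ 4 h)
    (hθ : ContDiffOn ℝ 4 θ U) {b₁ b₂ b₃ b₄ X₁ X₂ X₃ X₄ : ℝ} (hb₁ : ∀ t, ‖iteratedFDeriv ℝ 1 h t‖ ≤ b₁)
    (hb₂ : ∀ t, ‖iteratedFDeriv ℝ 2 h t‖ ≤ b₂) (hb₃ : ∀ t, ‖iteratedFDeriv ℝ 3 h t‖ ≤ b₃) (hb₄ : ∀ t, ‖iteratedFDeriv ℝ 4 h t‖ ≤ b₄)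
    (hX₁ : ‖iteratedFDerivWithin ℝ 1 θ U x‖ ≤ X₁) (hX₂ : ‖iteratedFDerivWithin ℝ 2 θ U x‖ ≤ X₂)
    (hX₃ : ‖iteratedFDerivWithin ℝ 3 θ U x‖ ≤ X₃) (hX₄ : ‖iteratedFDerivWithin ℝ 4 θ U x‖ ≤ X₄) :
    ‖iteratedFDerivWithin ℝ 4 (fun z => h (θ z)) U x‖ ≤
      b₄ * X₁ ^ 4 + 6 * b₃ * X₁ ^ 2 * X₂ + b₂ * (3 * X₂ ^ 2 + 4 * X₁ * X₃) + b₁ * X₄ := by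
  have hb₁0 : 0 ≤ b₁ := (norm_nonneg _).trans (hb₁ 0)
  have hb₂0 : 0 ≤ b₂ := (norm_nonneg _).trans (hb₂ 0)
  have hb₃0 : 0 ≤ b₃ := (norm_nonneg _).trans (hb₃ 0)
  have hb₄0 : 0 ≤ b₄ := (norm_nonneg _).trans (hb₄ 0)
  have hX₁0 : 0 ≤ X₁ := (norm_nonneg _).trans hX₁
  have hX₂0 : 0 ≤ X₂ := (norm_nonneg _).trans hX₂
  have hX₃0 : 0 ≤ X₃ := (norm_nonneg _).trans hX₃
  have hrec := norm_iteratedFDerivWithin_comp_succ_le hU hx (n := 3) hh hθ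
  simp only [Finset.sum_range_succ, Finset.sum_range_zero, zero_add, Nat.choose_zero_right, Nat.cast_one, one_mul, Nat.sub_zero,
    Nat.choose_self, show Nat.choose 3 1 = 3 by rfl, show Nat.choose 3 2 = 3 by rfl] at hrec
  rw [norm_iteratedFDerivWithin_zero_comp, abs_deriv_eq_norm_iteratedFDeriv_one] at hrec
  have hh' : ContDiff ℝ 3 (deriv h) := (contDiff_succ_iff_deriv (n := 3).mp hh).2.2
  have hb₁' : ∀ t, ‖iteratedFDeriv ℝ 1 (deriv h) t‖ ≤ b₂ := fun t => by rw [norm_iteratedFDeriv_deriv_eq]; exact hb₂ t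
  have hb₂' : ∀ t, ‖iteratedFDeriv ℝ 2 (deriv h) t‖ ≤ b₃ := fun t => by rw [norm_iteratedFDeriv_deriv_eq]; exact hb₃ t
  have hb₃' : ∀ t, ‖iteratedFDeriv ℝ 3 (deriv h) t‖ ≤ b₄ := fun t => by rw [norm_iteratedFDeriv_deriv_eq]; exact hb₄ t
  have h1 := norm_iteratedFDerivWithin_one_comp_le hU hx (hh'.of_le (by norm_num)) (hθ.of_le (by norm_num)) hb₁'
  have h2 := norm_iteratedFDerivWithin_two_comp_le hU hx (hh'.of_le (by norm_num)) (hθ.of_le (by norm_num)) hb₁' hb₂' hX₁ hX₂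
  have h3 := norm_iteratedFDerivWithin_three_comp_le hU hx hh' (hθ.of_le (by norm_num)) hb₁' hb₂' hb₃' hX₁ hX₂ hX₃
  calc ‖iteratedFDerivWithin ℝ 4 (fun z => h (θ z)) U x‖
      ≤ ‖iteratedFDeriv ℝ 1 h (θ x)‖ * ‖iteratedFDerivWithin ℝ 4 θ U x‖ +
          3 * ‖iteratedFDerivWithin ℝ 1 (fun z => deriv h (θ z)) U x‖ * ‖iteratedFDerivWithin ℝ 3 θ U x‖ +
          3 * ‖iteratedFDerivWithin ℝ 2 (fun z => deriv h (θ z)) U x‖ * ‖iteratedFDerivWithin ℝ 2 θ U x‖ +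
          ‖iteratedFDerivWithin ℝ 3 (fun z => deriv h (θ z)) U x‖ * ‖iteratedFDerivWithin ℝ 1 θ U x‖ := by
        simpa [show (3 : ℕ) - 1 + 1 = 3 from rfl, show (3 : ℕ) - 2 + 1 = 2 from rfl] using hrec
    _ ≤ b₁ * X₄ + 3 * (b₂ * X₁) * X₃ + 3 * (b₃ * X₁ ^ 2 + b₂ * X₂) * X₂ +
          (b₄ * X₁ ^ 3 + 3 * b₃ * X₁ * X₂ + b₂ * X₃) * X₁ := by
        gcongr
        · exact hb₁ _
        · exact h1.trans (mul_le_mul_of_nonneg_left hX₁ hb₂0)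
    _ = b₄ * X₁ ^ 4 + 6 * b₃ * X₁ ^ 2 * X₂ + b₂ * (3 * X₂ ^ 2 + 4 * X₁ * X₃) + b₁ * X₄ := by ring

/-- **The graded composition bounds, orders `1 … 4`, at a point of an open chart** (plain `iteratedFDeriv`s: `U` open). -/
theorem norm_iteratedFDeriv_comp_le_graded {g : ℝ → ℝ} (hU : IsOpen U) (hx : x ∈ U) (hg : ContDiff ℝ 4 g) (hθ : ContDiffOn ℝ 4 θ U)
    {b X : ℕ → ℝ} (hb : ∀ k, 1 ≤ k → k ≤ 4 → ∀ t, ‖iteratedFDeriv ℝ k g t‖ ≤ b k)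
    (hX : ∀ j, 1 ≤ j → j ≤ 4 → ‖iteratedFDeriv ℝ j θ x‖ ≤ X j) :
    ‖iteratedFDeriv ℝ 1 (fun z => g (θ z)) x‖ ≤ b 1 * X 1 ∧
    ‖iteratedFDeriv ℝ 2 (fun z => g (θ z)) x‖ ≤ b 2 * X 1 ^ 2 + b 1 * X 2 ∧
    ‖iteratedFDeriv ℝ 3 (fun z => g (θ z)) x‖ ≤ b 3 * X 1 ^ 3 + 3 * b 2 * X 1 * X 2 + b 1 * X 3 ∧
    ‖iteratedFDeriv ℝ 4 (fun z => g (θ z)) x‖ ≤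
      b 4 * X 1 ^ 4 + 6 * b 3 * X 1 ^ 2 * X 2 + b 2 * (3 * X 2 ^ 2 + 4 * X 1 * X 3) + b 1 * X 4 := by
  have hW : ∀ j, ‖iteratedFDerivWithin ℝ j θ U x‖ = ‖iteratedFDeriv ℝ j θ x‖ := fun j => by
    rw [iteratedFDerivWithin_of_isOpen j hU hx]
  have hX₁ : ‖iteratedFDerivWithin ℝ 1 θ U x‖ ≤ X 1 := by rw [hW]; exact hX 1 le_rfl (by norm_num)
  have hX₂ : ‖iteratedFDerivWithin ℝ 2 θ U x‖ ≤ X 2 := by rw [hW]; exact hX 2 (by norm_num) (by norm_num)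
  have hX₃ : ‖iteratedFDerivWithin ℝ 3 θ U x‖ ≤ X 3 := by rw [hW]; exact hX 3 (by norm_num) (by norm_num)
  have hX₄ : ‖iteratedFDerivWithin ℝ 4 θ U x‖ ≤ X 4 := by rw [hW]; exact hX 4 (by norm_num) le_rfl
  have hb₁ := hb 1 le_rfl (by norm_num); have hb₂ := hb 2 (by norm_num) (by norm_num)
  have hb₃ := hb 3 (by norm_num) (by norm_num); have hb₄ := hb 4 (by norm_num) le_rfl
  have hc : ∀ j, ‖iteratedFDeriv ℝ j (fun z => g (θ z)) x‖ = ‖iteratedFDerivWithin ℝ j (fun z => g (θ z)) U x‖ := fun j => by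
    rw [iteratedFDerivWithin_of_isOpen j hU hx]
  refine ⟨?_, ?_, ?_, ?_⟩
  · rw [hc]
    exact (norm_iteratedFDerivWithin_one_comp_le hU hx (hg.of_le (by norm_num)) (hθ.of_le (by norm_num)) hb₁).trans
      (mul_le_mul_of_nonneg_left hX₁ ((norm_nonneg _).trans (hb₁ 0)))
  · rw [hc]; exact norm_iteratedFDerivWithin_two_comp_le hU hx (hg.of_le (by norm_num)) (hθ.of_le (by norm_num)) hb₁ hb₂ hX₁ hX₂
  · rw [hc]; exact norm_iteratedFDerivWithin_three_comp_le hU hx (hg.of_le (by norm_num)) (hθ.of_le (by norm_num)) hb₁ hb₂ hb₃ hX₁ hX₂ hX₃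
  · rw [hc]; exact norm_iteratedFDerivWithin_four_comp_le hU hx hg hθ hb₁ hb₂ hb₃ hb₄ hX₁ hX₂ hX₃ hX₄

end Graded

/-! ## §2 Periodic functions of the argument / polar angle: the graded bounds with `‖Dʲarg(z)‖ ≤ (j−1)!/‖z‖ʲ` -/

section Arg

/-- **Graded bounds through a chart with argument-like jets**: if `θ` is `C⁴` on an open `U ∋ z` with `‖Dʲθ(z)‖ ≤ (j−1)!/rʲ` (`1 ≤ j ≤ 4`)
and `‖Dᵏg‖ ≤ b k` (`1 ≤ k ≤ 4`), then `‖D¹(g∘θ)(z)‖ ≤ b₁/r`, `‖D²‖ ≤ (b₂ + b₁)/r²`, `‖D³‖ ≤ (b₃ + 3b₂ + 2b₁)/r³`, `‖D⁴‖ ≤ (b₄ + 6b₃ + 11b₂ + 6b₁)/r⁴`. -/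
theorem norm_iteratedFDeriv_comp_le_graded_inv {F : Type*} [NormedAddCommGroup F] [NormedSpace ℝ F] {g : ℝ → ℝ} {θ : F → ℝ} {U : Set F}
    (hU : IsOpen U) {z : F} (hz : z ∈ U) (hg : ContDiff ℝ 4 g) (hθ : ContDiffOn ℝ 4 θ U) {b : ℕ → ℝ}
    (hb : ∀ k, 1 ≤ k → k ≤ 4 → ∀ t, ‖iteratedFDeriv ℝ k g t‖ ≤ b k) {r : ℝ} (hr : 0 < r)
    (hX : ∀ j, 1 ≤ j → j ≤ 4 → ‖iteratedFDeriv ℝ j θ z‖ ≤ ((j - 1).factorial : ℝ) / r ^ j) :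
    ‖iteratedFDeriv ℝ 1 (fun w => g (θ w)) z‖ ≤ b 1 / r ∧
    ‖iteratedFDeriv ℝ 2 (fun w => g (θ w)) z‖ ≤ (b 2 + b 1) / r ^ 2 ∧
    ‖iteratedFDeriv ℝ 3 (fun w => g (θ w)) z‖ ≤ (b 3 + 3 * b 2 + 2 * b 1) / r ^ 3 ∧
    ‖iteratedFDeriv ℝ 4 (fun w => g (θ w)) z‖ ≤ (b 4 + 6 * b 3 + 11 * b 2 + 6 * b 1) / r ^ 4 := by
  obtain ⟨h1, h2, h3, h4⟩ := norm_iteratedFDeriv_comp_le_graded hU hz hg hθ hb (X := fun j => ((j - 1).factorial : ℝ) / r ^ j) hX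
  have hr0 : r ≠ 0 := hr.ne'
  refine ⟨h1.trans (le_of_eq ?_), h2.trans (le_of_eq ?_), h3.trans (le_of_eq ?_), h4.trans (le_of_eq ?_)⟩
  · simp [div_eq_mul_inv]
  · simp only [Nat.factorial, Nat.succ_sub_one, Nat.cast_one]
    field_simp
    ring
  · simp only [Nat.factorial, Nat.succ_sub_one, Nat.cast_one]
    field_simp
    ring
  · simp only [Nat.factorial, Nat.succ_sub_one, Nat.cast_one]
    field_simp
    ring

/-- **Graded bounds for a periodic function of the argument** at `z` with `‖z‖ ≥ r > 0` (both charts: the slit plane and, on the negative real axis,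
`g(arg w) = g(arg(−w) + π)`). -/
theorem norm_iteratedFDeriv_comp_arg_le_graded {g : ℝ → ℝ} (hg : ContDiff ℝ 4 g) (hper : Function.Periodic g (2 * Real.pi)) {z : ℂ}
    {r : ℝ} (hr : 0 < r) (hrz : r ≤ ‖z‖) {b : ℕ → ℝ} (hb : ∀ k, 1 ≤ k → k ≤ 4 → ∀ t, ‖iteratedFDeriv ℝ k g t‖ ≤ b k) :
    ‖iteratedFDeriv ℝ 1 (fun w => g (Complex.arg w)) z‖ ≤ b 1 / r ∧
    ‖iteratedFDeriv ℝ 2 (fun w => g (Complex.arg w)) z‖ ≤ (b 2 + b 1) / r ^ 2 ∧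
    ‖iteratedFDeriv ℝ 3 (fun w => g (Complex.arg w)) z‖ ≤ (b 3 + 3 * b 2 + 2 * b 1) / r ^ 3 ∧
    ‖iteratedFDeriv ℝ 4 (fun w => g (Complex.arg w)) z‖ ≤ (b 4 + 6 * b 3 + 11 * b 2 + 6 * b 1) / r ^ 4 := by
  have hz : z ≠ 0 := by
    intro h; rw [h, norm_zero] at hrz; exact absurd hrz (not_le.mpr hr)
  -- jets of the argument in either chart are `≤ (j−1)!/‖z‖ʲ ≤ (j−1)!/rʲ`
  have hmono : ∀ j : ℕ, ((j - 1).factorial : ℝ) / ‖z‖ ^ j ≤ ((j - 1).factorial : ℝ) / r ^ j := fun j =>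
    div_le_div_of_nonneg_left (by positivity) (by positivity) (pow_le_pow_left₀ hr.le hrz j)
  by_cases hs : z ∈ slitPlane
  · refine norm_iteratedFDeriv_comp_le_graded_inv isOpen_slitPlane hs hg
      (fun w hw => (contDiffAt_arg_of_mem_slitPlane hw).contDiffWithinAt) hb hr fun j hj1 hj4 => ?_
    obtain ⟨l, rfl⟩ : ∃ l, j = l + 1 := ⟨j - 1, by omega⟩
    exact (norm_iteratedFDeriv_arg_le hs l).trans (by simpa using hmono (l + 1))
  · rw [mem_slitPlane_iff, not_or, not_lt] at hs
    have hre : z.re < 0 := lt_of_le_of_ne hs.1 fun h => by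
      apply hz; apply Complex.ext <;> simp [h, not_not.1 hs.2]
    have hev := arg_neg_add_pi_eventuallyEq hper hre
    have hU : IsOpen {w : ℂ | w.re < 0} := isOpen_lt continuous_re continuous_const
    have hch : ∀ w : ℂ, w.re < 0 → ContDiffAt ℝ 4 (fun w : ℂ => Complex.arg (-w)) w := fun w hw =>
      (contDiffAt_arg_of_mem_slitPlane (Or.inl (by simpa using hw))).comp w contDiff_neg.contDiffAt
    have hθ₂ : ContDiffOn ℝ 4 (fun w : ℂ => Complex.arg (-w) + Real.pi) {w : ℂ | w.re < 0} := fun w hw =>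
      ((hch w hw).add contDiffAt_const).contDiffWithinAt
    have hjet : ∀ j, 1 ≤ j → j ≤ 4 → ‖iteratedFDeriv ℝ j (fun w : ℂ => Complex.arg (-w) + Real.pi) z‖ ≤ ((j - 1).factorial : ℝ) / r ^ j := by
      intro j hj1 hj4
      obtain ⟨l, rfl⟩ : ∃ l, j = l + 1 := ⟨j - 1, by omega⟩
      have hneg : -z ∈ slitPlane := Or.inl (by simpa using hre)
      have h1 : iteratedFDeriv ℝ (l + 1) (fun w : ℂ => Complex.arg (-w) + Real.pi) z =
          iteratedFDeriv ℝ (l + 1) (fun w : ℂ => Complex.arg (-w)) z := by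
        have hc : ContDiffAt ℝ ((l + 1 : ℕ) : WithTop ℕ∞) (fun _ : ℂ => (Real.pi : ℝ)) z := contDiffAt_const
        have ha : ContDiffAt ℝ ((l + 1 : ℕ) : WithTop ℕ∞) (fun w : ℂ => Complex.arg (-w)) z :=
          (hch z hre).of_le (by exact_mod_cast hj4)
        rw [show (fun w : ℂ => Complex.arg (-w) + Real.pi) = (fun w : ℂ => Complex.arg (-w)) + fun _ => (Real.pi : ℝ) from rfl,
          iteratedFDeriv_add_apply ha hc, iteratedFDeriv_const_of_ne (by omega), Pi.zero_apply, add_zero]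
      rw [h1]
      exact (norm_iteratedFDeriv_arg_neg_le hneg l).trans (by simpa using hmono (l + 1))
    obtain ⟨g1, g2, g3, g4⟩ := norm_iteratedFDeriv_comp_le_graded_inv hU hre hg hθ₂ hb hr hjet
    refine ⟨?_, ?_, ?_, ?_⟩
    · rw [(hev.iteratedFDeriv ℝ 1).eq_of_nhds]; exact g1
    · rw [(hev.iteratedFDeriv ℝ 2).eq_of_nhds]; exact g2
    · rw [(hev.iteratedFDeriv ℝ 3).eq_of_nhds]; exact g3
    · rw [(hev.iteratedFDeriv ℝ 4).eq_of_nhds]; exact g4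

/-- **Graded bounds for a periodic function of the polar angle on momentum space**: for `g` `C⁴`, `2π`-periodic with `‖Dᵏg‖ ≤ b k`
(`1 ≤ k ≤ 4`) and `‖q‖ ≥ r > 0`: `‖D¹(g∘polarAngle)(q)‖ ≤ b₁/r`, `‖D²‖ ≤ (b₂ + b₁)/r²`, `‖D³‖ ≤ (b₃ + 3b₂ + 2b₁)/r³`,
`‖D⁴‖ ≤ (b₄ + 6b₃ + 11b₂ + 6b₁)/r⁴` — the Bell-graded replacement of `norm_iteratedFDeriv_comp_polarAngle_le` (`n!·G·Θⁿ`). -/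
theorem norm_iteratedFDeriv_comp_polarAngle_le_graded {g : ℝ → ℝ} (hg : ContDiff ℝ 4 g) (hper : Function.Periodic g (2 * Real.pi))
    {q : Momentum} {r : ℝ} (hr : 0 < r) (hrq : r ≤ ‖q‖) {b : ℕ → ℝ} (hb : ∀ k, 1 ≤ k → k ≤ 4 → ∀ t, ‖iteratedFDeriv ℝ k g t‖ ≤ b k) :
    ‖iteratedFDeriv ℝ 1 (fun q : Momentum => g (polarAngle (WithLp.ofLp q))) q‖ ≤ b 1 / r ∧
    ‖iteratedFDeriv ℝ 2 (fun q : Momentum => g (polarAngle (WithLp.ofLp q))) q‖ ≤ (b 2 + b 1) / r ^ 2 ∧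
    ‖iteratedFDeriv ℝ 3 (fun q : Momentum => g (polarAngle (WithLp.ofLp q))) q‖ ≤ (b 3 + 3 * b 2 + 2 * b 1) / r ^ 3 ∧
    ‖iteratedFDeriv ℝ 4 (fun q : Momentum => g (polarAngle (WithLp.ofLp q))) q‖ ≤ (b 4 + 6 * b 3 + 11 * b 2 + 6 * b 1) / r ^ 4 := by
  obtain ⟨ι, hι, hιn⟩ := exists_momToComplexCLM
  have hnormq : ‖ι q‖ = ‖q‖ := by
    rw [hι]
    have h1 : ‖momToComplex (WithLp.ofLp q)‖ ^ 2 = ‖q‖ ^ 2 := by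
      rw [Complex.sq_norm, Complex.normSq_apply, momToComplex_re, momToComplex_im, EuclideanSpace.norm_sq_eq, Fin.sum_univ_two,
        Real.norm_eq_abs, Real.norm_eq_abs, sq_abs, sq_abs]
      ring
    nlinarith [norm_nonneg (momToComplex (WithLp.ofLp q)), norm_nonneg q]
  have hq : q ≠ 0 := by
    intro h; rw [h, norm_zero] at hrq; exact absurd hrq (not_le.mpr hr)
  have hz : ι q ≠ 0 := by
    intro h; apply hq
    have : ‖q‖ = 0 := by rw [← hnormq, h, norm_zero]
    exact norm_eq_zero.mp this
  have hfun : (fun q : Momentum => g (polarAngle (WithLp.ofLp q))) = (fun w => g (Complex.arg w)) ∘ ι := by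
    funext q'; simp [polarAngle, hι]
  set s : Set ℂ := {w | w ≠ 0} with hs
  have hso : IsOpen s := isOpen_ne
  have hpo : IsOpen (ι ⁻¹' s) := hso.preimage ι.continuous
  have hqs : q ∈ ι ⁻¹' s := hz
  have hmain := norm_iteratedFDeriv_comp_arg_le_graded hg hper hr (by rw [hnormq]; exact hrq) hb
  -- transport of each order through `ι` (norm ≤ 1)
  have htrans : ∀ n : ℕ, n ≤ 4 → ‖iteratedFDeriv ℝ n (fun q : Momentum => g (polarAngle (WithLp.ofLp q))) q‖ ≤
      ‖iteratedFDeriv ℝ n (fun w => g (Complex.arg w)) (ι q)‖ := by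
    intro n hn
    have hn' : (n : WithTop ℕ∞) ≤ 4 := by exact_mod_cast hn
    rw [hfun, ← iteratedFDerivWithin_of_isOpen n hpo hqs,
      ContinuousLinearMap.iteratedFDerivWithin_comp_right ι (hg.contDiffOn_comp_arg hper) hso.uniqueDiffOn hpo.uniqueDiffOn hz hn',
      iteratedFDerivWithin_of_isOpen n hso hz]
    refine (ContinuousMultilinearMap.norm_compContinuousLinearMap_le _ _).trans ?_
    have hprod : ∏ _i : Fin n, ‖ι‖ ≤ 1 := by
      rw [Finset.prod_const, Finset.card_univ, Fintype.card_fin]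
      exact pow_le_one₀ (norm_nonneg _) hιn
    have h0 : 0 ≤ ‖iteratedFDeriv ℝ n (fun w => g (Complex.arg w)) (ι q)‖ := norm_nonneg _
    calc ‖iteratedFDeriv ℝ n (fun w => g (Complex.arg w)) (ι q)‖ * ∏ _i : Fin n, ‖ι‖
        ≤ ‖iteratedFDeriv ℝ n (fun w => g (Complex.arg w)) (ι q)‖ * 1 := mul_le_mul_of_nonneg_left hprod h0
      _ = _ := mul_one _
  obtain ⟨m1, m2, m3, m4⟩ := hmain
  exact ⟨(htrans 1 (by norm_num)).trans m1, (htrans 2 (by norm_num)).trans m2, (htrans 3 (by norm_num)).trans m3,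
    (htrans 4 le_rfl).trans m4⟩

end Arg

end Summit.HubbardSuperconductivity.HubbardSuperconductivity.Theorems.KLRegimeSplit

end
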